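import Literature.NumberTheory.LFunctions.WeilTwoPrimeOddMarginKBase
import Literature.NumberTheory.LFunctions.WeilTwoPrimeOddMarginKDataP9
import Literature.NumberTheory.LFunctions.WeilBlockRowsPZ
import Literature.NumberTheory.LFunctions.WeilBlockRowsFast
import HarnessLib

/-!
# Two-prime odd-margin certificate K: dominance of rows 40–44 of `R = S'_odd(κ') − UᵀU` (factored data)

`WeilCert.checkDomRowPZ` with the materialized block `weilCert23KPm`, the factored inverse `weilCert23KDn/weilCert23KLs` and the Bessel block `weilCert23KHp`, row by row via the linear-traversal check `WeilCert.checkDomRowF` (`decide +kernel`) and `WeilCert.checkDomRowPZ_of_F`; converted to `checkDomRow` by `WeilCert.checkDomRow_of_PZ` in the assembly file. Pure proof file.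
-/

noncomputable section

namespace Literature.NumberTheory.LFunctions

set_option maxHeartbeats 0 in
/-- Kernel check of the dominance of row 40 of `R` (certificate K, factored data). [folklore] -/
theorem checkDomRowPZ1_40_weilCert23K :
    weilCert23KBase.checkDomRowPZ weilCert23KPm weilCert23KDn weilCert23KLs weilCert23KHp weilCert23KKappa' 1 40 = true :=
  WeilCert.checkDomRowPZ_of_F (by decide) (by decide +kernel : weilCert23KBase.checkDomRowF weilCert23KPm weilCert23KDn weilCert23KLs weilCert23KHp weilCert23KKappa' 1 40 = true)

set_option maxHeartbeats 0 in
/-- Kernel check of the dominance of row 41 of `R` (certificate K, factored data). [folklore] -/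
theorem checkDomRowPZ1_41_weilCert23K :
    weilCert23KBase.checkDomRowPZ weilCert23KPm weilCert23KDn weilCert23KLs weilCert23KHp weilCert23KKappa' 1 41 = true :=
  WeilCert.checkDomRowPZ_of_F (by decide) (by decide +kernel : weilCert23KBase.checkDomRowF weilCert23KPm weilCert23KDn weilCert23KLs weilCert23KHp weilCert23KKappa' 1 41 = true)

set_option maxHeartbeats 0 in
/-- Kernel check of the dominance of row 42 of `R` (certificate K, factored data). [folklore] -/
theorem checkDomRowPZ1_42_weilCert23K :
    weilCert23KBase.checkDomRowPZ weilCert23KPm weilCert23KDn weilCert23KLs weilCert23KHp weilCert23KKappa' 1 42 = true :=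
  WeilCert.checkDomRowPZ_of_F (by decide) (by decide +kernel : weilCert23KBase.checkDomRowF weilCert23KPm weilCert23KDn weilCert23KLs weilCert23KHp weilCert23KKappa' 1 42 = true)

set_option maxHeartbeats 0 in
/-- Kernel check of the dominance of row 43 of `R` (certificate K, factored data). [folklore] -/
theorem checkDomRowPZ1_43_weilCert23K :
    weilCert23KBase.checkDomRowPZ weilCert23KPm weilCert23KDn weilCert23KLs weilCert23KHp weilCert23KKappa' 1 43 = true :=
  WeilCert.checkDomRowPZ_of_F (by decide) (by decide +kernel : weilCert23KBase.checkDomRowF weilCert23KPm weilCert23KDn weilCert23KLs weilCert23KHp weilCert23KKappa' 1 43 = true)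

set_option maxHeartbeats 0 in
/-- Kernel check of the dominance of row 44 of `R` (certificate K, factored data). [folklore] -/
theorem checkDomRowPZ1_44_weilCert23K :
    weilCert23KBase.checkDomRowPZ weilCert23KPm weilCert23KDn weilCert23KLs weilCert23KHp weilCert23KKappa' 1 44 = true :=
  WeilCert.checkDomRowPZ_of_F (by decide) (by decide +kernel : weilCert23KBase.checkDomRowF weilCert23KPm weilCert23KDn weilCert23KLs weilCert23KHp weilCert23KKappa' 1 44 = true)


end Literature.NumberTheory.LFunctions
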